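import Summits.HodgeConjecture.CorCM.Census.DihedralSexticPairCurvePowers
import Summits.HodgeConjecture.CorCM.DihedralSexticPairCurveGenerators
import Summits.HodgeConjecture.CorCM.CMWeightDistribution
import HarnessLib

/-!
# COR-CM — the Hodge conjecture for ALL POWERS `E^c × B₀^a × B₁^b` of the sextic CM threefold pair modulo Markman's
# fourfold theorem: frame transfer for `⨁_j A₃(κ j)` and assembly (frame form)

Cell `pub-hodgecm2` (COR-CM), seat b30 gen 15 (2026-08-21); COUNT-NEUTRAL; theorems only, no definition, no named fact,
no `sorry`.  The power analogue of `CorCM/DihedralSexticPairCurveTransfer.lean` + `…CurveHodgeOfMarkman.lean` (gen 14,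
ONE copy of each factor).  SETTING as there: fields `Kf : I → Type`, `k = Kf i₀` (quadratic, `τ`), `K = Kf i₁` (sextic,
`i : k → K`), three slots `curveSlots i₀ i₁ = (i₀, i₁, i₁)` with realisations `A₃ m ⊨ (Kf (curveSlots m); Φ₃ m)` read in a
frame `e` (`hΨ`, `hΦ`, `he_conj`, `he_sign`, `he_gal`); NEW: an arbitrary slot map `κ : Fin N → Fin 3` and the power
`X = ⨁_j A₃ (κ j)` (any number of copies of `E = A₃ 0`, `B₀ = A₃ 1`, `B₁ = A₃ 2`), with the pulled-back realisation
family.  The index set of `X` projects to that of `Y = ⨁ A₃` by `P = Sigma.map κ id`, and to the 14-point model by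
`v = toPt' e τ ∘ P` (a CONFIGURATION in the sense of `Census/DihedralSexticPairCurvePowers.lean`).

* §1 `modelBalanced_of_isGaloisBalancedAlg` — an `Aut(ℂ)`-balanced weight of `X` (Pohlmann's condition for the CM
  algebra `∏_j K_{κ j}`) is a balanced configuration (realise the twelve `g ∈ S₃ × C₂` by automorphisms of `ℂ`,
  gen 14's `exists_ringEquiv_realises` + `comp_mem_iff_act'_mem_phi'`);
* §2 `exists_weightClassesAlg_le_algebraicClasses_of_part` — a part `G` of a weight of `X` on which `v` is injective
  and whose image is a generating weight has an algebraic weight line: its projection `P(G)` is a weight of `Y` with the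
  same model image, algebraic on `Y` (conjugate pairs: divisors; `weil4`/`pair6`: the hypotheses `hweil4`/`hpair6`,
  discharged from Markman in §4), and THE DISTRIBUTION LEMMA `CMWeights.weightClassesAlg_comp_le_algebraicClasses_of_injOn`
  lifts it to `X`;
* §3 `hodgeConjectureFor_biproduct_comp_of_generators` — Pohlmann's theorem for `X`, §1, the induction principle
  `modelBalanced_induction` of the census file, §2 and the multiplicativity of algebraic weight lines;
* §4 **`hodgeConjectureFor_biproduct_comp_of_frame_of_markman`** — `HodgeConjectureFor (⨁_j A₃ (κ j))` for EVERY `κ`,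
  GIVEN ONLY `Markman2025_weilClasses_algebraic_abelianFourfold` (frame form), and the `AVDominatedBy` form (every
  abelian variety whose simple factors are among `E`, `B₀`, `B₁`, once dominated by a power).
HONEST FRAMING: conditional on Markman only; `HC_CM` is not asserted.  The intrinsic / geometric forms (no frame in
the statement) are in `CorCM/SexticCMThreefoldPairPowersHodgeOfMarkman.lean`.
[cite: Markman2025SurveySecant, Thm. 1.2] [cite: Pohlmann1968, Thm 1] [cite: GaoUllmo2025, Thm 3.1]
[cite: Milne2020HodgeClassesAV, 1.2 (a) and Thm. 1] [cite: MoonenZarhin1999LowDim, Thm. 0.1]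

## References
* [Markman2025SurveySecant] E. Markman, arXiv:2509.23403, Thm. 1.2.  [Pohlmann1968] Ann. of Math. 88, Thm 1.
  [GaoUllmo2025] J. Inst. Math. Jussieu 25, Thm 3.1.  [Milne2020HodgeClassesAV] arXiv:2010.08857, 1.2 (a), Thm. 1.
  [MoonenZarhin1999LowDim] Duke 98 (1999), Thm. 0.1.  [MumfordAV1970] §19.
-/

noncomputable section

open CategoryTheory CategoryTheory.Limits NumberField

namespace Summit.HodgeConjecture.CorCM.DihedralSexticPairCurvePowers

open Literature.AlgebraicGeometry Literature.AlgebraicGeometry.Motives Literature.AlgebraicGeometry.HodgeTheory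
open Literature.AlgebraicGeometry.ComplexMultiplication (IsCMTypeRealisation)
open Literature.AlgebraicGeometry.Pohlmann1968
open Summit.HodgeConjecture.CorCM.Census.DihedralSexticPairCurve (Pt' act' phi' conjPair weil4 pair6 gens mem_gens_iff
  gens_balanced)
open Summit.HodgeConjecture.CorCM.Census.DihedralSexticPairCurvePowers (ModelBalanced modelBalanced_induction)
open Summit.HodgeConjecture.CorCM.DihedralSexticPair (exists_ringEquiv_realises)
open Summit.HodgeConjecture.CorCM.DihedralSexticPairCurve (curveSlots toPt' toPt'_injective comp_mem_iff_act'_mem_phi'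
  weightClassesAlg_le_algebraicClasses_of_image_eq_conjPair weightClassesAlg_le_algebraicClasses_of_image_eq_weil4
  weightClassesAlg_le_algebraicClasses_of_image_eq_pair6)
open Summit.HodgeConjecture.CorCM.PairWeights (weightClassesAlg_union_le_algebraicClasses)
open Summit.HodgeConjecture.CorCM.CMWeights (weightClassesAlg_comp_le_algebraicClasses_of_injOn)

open scoped Classical

/-! ## §1 Frame transfer for the powers -/

section Transfer

variable {I : Type} {Kf : I → Type} [∀ i, Field (Kf i)] {i₀ i₁ : I} {N : ℕ} (κ : Fin N → Fin 3)
  {e : (Kf i₁ →+* ℂ) ≃ ZMod 3 × Bool} {τ : Kf i₀ →+* ℂ} {i : Kf i₀ →+* Kf i₁}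
  (hττ : ComplexEmbedding.conjugate τ ≠ τ) (hk : ∀ σ : Kf i₀ →+* ℂ, σ = τ ∨ σ = ComplexEmbedding.conjugate τ)
  (he_sign : ∀ s : Kf i₁ →+* ℂ, s.comp i = τ ↔ (e s).2 = true)
  (he_conj : ∀ s : Kf i₁ →+* ℂ, e (ComplexEmbedding.conjugate s) = ((e s).1, !(e s).2))
  (he_gal : ∀ (j : ZMod 3) (f : Bool), ∃ σ : ℂ ≃+* ℂ, ∀ s : Kf i₁ →+* ℂ,
    e ((σ : ℂ →+* ℂ).comp s) = ((if f then -(e s).1 else (e s).1) + j, (e s).2))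
  {Φ₃ : ∀ m : Fin 3, CMType (Kf (curveSlots i₀ i₁ m))}
  (hΨ : ∀ σ : Kf i₀ →+* ℂ, σ ∈ (Φ₃ 0).1 ↔ σ = τ)
  (hΦ : ∀ (m : Fin 2) (s : Kf i₁ →+* ℂ), s ∈ (Φ₃ m.succ).1 ↔ (e s).2 = decide ((e s).1.val = m.val))

/-- Counting a decidable property over a finset as a set. [folklore] -/
theorem ncard_sep_eq_card_filter {β : Type*} (S : Finset β) (Q : β → Prop) [DecidablePred Q] :
    {x | x ∈ S ∧ Q x}.ncard = (S.filter Q).card := by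
  rw [show {x | x ∈ S ∧ Q x} = ↑(S.filter Q) by ext x; simp, Set.ncard_coe_finset]

include hττ hk he_sign he_conj he_gal hΨ hΦ in
/-- **FRAME TRANSFER FOR THE POWERS**: an `Aut(ℂ)`-balanced weight of `X = ⨁_j A₃(κ j)` (`IsGaloisBalancedAlg` for the
CM algebra `∏_j K_{κ j}`, types `Φ₃ (κ j)`) is a balanced configuration of the 14-point model under
`v = toPt' e τ ∘ P`, `P (j, s) = (κ j, s)` (the twelve elements of `S₃ × C₂` are realised by automorphisms of `ℂ`).
[cite: GaoUllmo2025, Thm 3.1 (3.2)] -/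
theorem modelBalanced_of_isGaloisBalancedAlg {S : Finset ((j : Fin N) × (Kf (curveSlots i₀ i₁ (κ j)) →+* ℂ))}
    (hS : IsGaloisBalancedAlg (K := fun j => Kf (curveSlots i₀ i₁ (κ j))) (fun j => Φ₃ (κ j)) S) :
    ModelBalanced (fun x => toPt' e τ ((Sigma.map κ (fun _ => id) :
      ((j : Fin N) × (Kf (curveSlots i₀ i₁ (κ j)) →+* ℂ)) → ((m : Fin 3) × (Kf (curveSlots i₀ i₁ m) →+* ℂ))) x)) S := by
  intro j f d
  obtain ⟨ρ, hρ⟩ := exists_ringEquiv_realises he_conj he_gal j f d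
  have h := hS ρ
  rw [ncard_sep_eq_card_filter, ncard_sep_eq_card_filter] at h
  have key : ∀ x : (j : Fin N) × (Kf (curveSlots i₀ i₁ (κ j)) →+* ℂ),
      (ρ : ℂ →+* ℂ).comp x.2 ∈ (Φ₃ (κ x.1)).1 ↔ act' j f d (toPt' e τ ((Sigma.map κ (fun _ => id) :
        ((j : Fin N) × (Kf (curveSlots i₀ i₁ (κ j)) →+* ℂ)) → ((m : Fin 3) × (Kf (curveSlots i₀ i₁ m) →+* ℂ))) x))
          ∈ phi' :=
    fun x => comp_mem_iff_act'_mem_phi' hττ hk he_sign hΨ hΦ hρ ⟨κ x.1, x.2⟩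
  rw [Finset.filter_congr fun x _ => key x, Finset.filter_congr fun x _ => (key x).not] at h
  exact h

end Transfer

/-! ## §2 Generating parts of a weight of the power have algebraic lines -/

section Parts

variable {I : Type} {Kf : I → Type} [∀ i, Field (Kf i)] [∀ i, NumberField (Kf i)] [∀ i, IsCMField (Kf i)]
  {i₀ i₁ : I} {N : ℕ} (κ : Fin N → Fin 3) {e : (Kf i₁ →+* ℂ) ≃ ZMod 3 × Bool} {τ : Kf i₀ →+* ℂ}
  (hττ : ComplexEmbedding.conjugate τ ≠ τ) (hk : ∀ σ : Kf i₀ →+* ℂ, σ = τ ∨ σ = ComplexEmbedding.conjugate τ)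
  (he_conj : ∀ s : Kf i₁ →+* ℂ, e (ComplexEmbedding.conjugate s) = ((e s).1, !(e s).2))
  {A₃ : Fin 3 → AbelianVariety ℂ} {Φ₃ : ∀ m : Fin 3, CMType (Kf (curveSlots i₀ i₁ m))}
  {ι₃ : ∀ m, 𝓞 (Kf (curveSlots i₀ i₁ m)) →+* End (A₃ m)}
  {θ₃ : ∀ m, Kf (curveSlots i₀ i₁ m) →+* Module.End ℂ (complexBetti (A₃ m).X 1)}
  (hA : ∀ m, IsCMTypeRealisation (Φ₃ m) (A₃ m) (ι₃ m) (θ₃ m))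
  (hweil4 : ∀ (m : Fin 2) (b : Bool) (T : Finset ((m : Fin 3) × (Kf (curveSlots i₀ i₁ m) →+* ℂ))),
    T.image (toPt' e τ) = weil4 m b → weightClassesAlg A₃ ι₃ (2 * 2) T ≤ algebraicClasses (⨁ A₃).X 2)
  (hpair6 : ∀ (b : Bool) (T : Finset ((m : Fin 3) × (Kf (curveSlots i₀ i₁ m) →+* ℂ))),
    T.image (toPt' e τ) = pair6 b → weightClassesAlg A₃ ι₃ (2 * 3) T ≤ algebraicClasses (⨁ A₃).X 3)

include hττ hk he_conj hA hweil4 hpair6 in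
/-- **A generating part of a weight of `X = ⨁_j A₃(κ j)` has an algebraic weight line.**  If `v = toPt' ∘ P` is
injective on `G` and `v(G)` is `conjPair y`, `weil4 m b` or `pair6 b`, then `G` has `2q` elements (`q = 1, 2, 3`) and
`H^{2q}(X)_G ⊆ N^q`: the projected weight `P(G)` of `Y = ⨁ A₃` has the same model image, hence an algebraic line on `Y`
(divisor pair, resp. the hypotheses `hweil4`, `hpair6`), and the distribution lemma lifts it along `κ`.
[cite: Milne2020HodgeClassesAV, 1.2 (a) and Thm. 1] [cite: Markman2025SurveySecant, Thm. 1.2] -/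
theorem exists_weightClassesAlg_le_algebraicClasses_of_part
    {G : Finset ((j : Fin N) × (Kf (curveSlots i₀ i₁ (κ j)) →+* ℂ))}
    (hinj : Set.InjOn (fun x => toPt' e τ ((Sigma.map κ (fun _ => id) :
      ((j : Fin N) × (Kf (curveSlots i₀ i₁ (κ j)) →+* ℂ)) → ((m : Fin 3) × (Kf (curveSlots i₀ i₁ m) →+* ℂ))) x)) ↑G)
    (hG : G.image (fun x => toPt' e τ ((Sigma.map κ (fun _ => id) :
      ((j : Fin N) × (Kf (curveSlots i₀ i₁ (κ j)) →+* ℂ)) → ((m : Fin 3) × (Kf (curveSlots i₀ i₁ m) →+* ℂ))) x))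
        ∈ gens) :
    ∃ q : ℕ, G.card = 2 * q ∧ weightClassesAlg (fun j => A₃ (κ j)) (fun j => ι₃ (κ j)) (2 * q) G ≤
      algebraicClasses (⨁ fun j => A₃ (κ j)).X q := by
  set P : ((j : Fin N) × (Kf (curveSlots i₀ i₁ (κ j)) →+* ℂ)) → ((m : Fin 3) × (Kf (curveSlots i₀ i₁ m) →+* ℂ)) :=
    Sigma.map κ (fun _ => id) with hP
  have hPinj : Set.InjOn P ↑G := fun x hx y hy h => hinj hx hy (by simp only [h])
  set TY : Finset ((m : Fin 3) × (Kf (curveSlots i₀ i₁ m) →+* ℂ)) := G.image P with hTY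
  have hTYimg : TY.image (toPt' e τ) = G.image (fun x => toPt' e τ (P x)) := by rw [hTY, Finset.image_image]; rfl
  have hTYcard : TY.card = G.card := Finset.card_image_of_injOn hPinj
  have hGcard_img : G.card = (G.image fun x => toPt' e τ (P x)).card := (Finset.card_image_of_injOn hinj).symm
  -- the projected weight is algebraic on `Y`, of the right size
  obtain ⟨q, hq, hYalg⟩ : ∃ q, G.card = 2 * q ∧ weightClassesAlg A₃ ι₃ (2 * q) TY ≤ algebraicClasses (⨁ A₃).X q := by
    rcases (mem_gens_iff _).1 hG with ⟨y, hy⟩ | ⟨m, b, hy⟩ | hy | hy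
    · obtain ⟨hc, halg⟩ := weightClassesAlg_le_algebraicClasses_of_image_eq_conjPair hττ hk he_conj hA
        (T := TY) (y := y) (by rw [hTYimg, hy])
      exact ⟨1, by rw [← hTYcard, hc], halg⟩
    · refine ⟨2, ?_, hweil4 m b TY (by rw [hTYimg, hy])⟩
      rw [hGcard_img, hy]; exact (gens_balanced.2.1 m b).2.1
    · refine ⟨3, ?_, hpair6 true TY (by rw [hTYimg, hy])⟩
      rw [hGcard_img, hy]; exact (gens_balanced.2.2 true).2.1
    · refine ⟨3, ?_, hpair6 false TY (by rw [hTYimg, hy])⟩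
      rw [hGcard_img, hy]; exact (gens_balanced.2.2 false).2.1
  -- the distribution lemma lifts it to `X`
  exact ⟨q, hq, weightClassesAlg_comp_le_algebraicClasses_of_injOn (K := fun m => Kf (curveSlots i₀ i₁ m)) hA κ hq
    hPinj hYalg⟩

end Parts

/-! ## §3 Assembly from the generator hypotheses -/

section Assembly

variable {I : Type} {Kf : I → Type} [∀ i, Field (Kf i)] [∀ i, NumberField (Kf i)] [∀ i, IsCMField (Kf i)]
  {i₀ i₁ : I} {N : ℕ} (κ : Fin N → Fin 3) {e : (Kf i₁ →+* ℂ) ≃ ZMod 3 × Bool} {τ : Kf i₀ →+* ℂ} {i : Kf i₀ →+* Kf i₁}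
  {A₃ : Fin 3 → AbelianVariety ℂ} {Φ₃ : ∀ m : Fin 3, CMType (Kf (curveSlots i₀ i₁ m))}
  {ι₃ : ∀ m, 𝓞 (Kf (curveSlots i₀ i₁ m)) →+* End (A₃ m)}
  {θ₃ : ∀ m, Kf (curveSlots i₀ i₁ m) →+* Module.End ℂ (complexBetti (A₃ m).X 1)}

/-- **`HodgeConjectureFor (⨁_j A₃ (κ j))` from the frame and the two generator hypotheses on `Y = ⨁ A₃`** (any slot
map `κ`): every rational `(p,p)`-class of the power is algebraic.  Pohlmann's theorem for the CM algebra
`∏_j K_{κ j}`, frame transfer (§1), the induction principle for balanced configurations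
(`Census/DihedralSexticPairCurvePowers.lean`), §2, and the multiplicativity of algebraic weight lines.
[cite: Pohlmann1968, Thm 1] [cite: GaoUllmo2025, Thm 3.1] [cite: Milne2020HodgeClassesAV, 1.2 (a) and Thm. 1] -/
theorem hodgeConjectureFor_biproduct_comp_of_generators
    (hττ : ComplexEmbedding.conjugate τ ≠ τ) (hk : ∀ σ : Kf i₀ →+* ℂ, σ = τ ∨ σ = ComplexEmbedding.conjugate τ)
    (hA : ∀ m, IsCMTypeRealisation (Φ₃ m) (A₃ m) (ι₃ m) (θ₃ m))
    (he_conj : ∀ s : Kf i₁ →+* ℂ, e (ComplexEmbedding.conjugate s) = ((e s).1, !(e s).2))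
    (he_sign : ∀ s : Kf i₁ →+* ℂ, s.comp i = τ ↔ (e s).2 = true)
    (he_gal : ∀ (j : ZMod 3) (f : Bool), ∃ σ : ℂ ≃+* ℂ, ∀ s : Kf i₁ →+* ℂ,
      e ((σ : ℂ →+* ℂ).comp s) = ((if f then -(e s).1 else (e s).1) + j, (e s).2))
    (hΨ : ∀ σ : Kf i₀ →+* ℂ, σ ∈ (Φ₃ 0).1 ↔ σ = τ)
    (hΦ : ∀ (m : Fin 2) (s : Kf i₁ →+* ℂ), s ∈ (Φ₃ m.succ).1 ↔ (e s).2 = decide ((e s).1.val = m.val))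
    (hweil4 : ∀ (m : Fin 2) (b : Bool) (T : Finset ((m : Fin 3) × (Kf (curveSlots i₀ i₁ m) →+* ℂ))),
      T.image (toPt' e τ) = weil4 m b → weightClassesAlg A₃ ι₃ (2 * 2) T ≤ algebraicClasses (⨁ A₃).X 2)
    (hpair6 : ∀ (b : Bool) (T : Finset ((m : Fin 3) × (Kf (curveSlots i₀ i₁ m) →+* ℂ))),
      T.image (toPt' e τ) = pair6 b → weightClassesAlg A₃ ι₃ (2 * 3) T ≤ algebraicClasses (⨁ A₃).X 3) :
    HodgeConjectureFor (⨁ fun j => A₃ (κ j)).dim (⨁ fun j => A₃ (κ j)).X := by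
  refine ⟨nonempty_hodgeModel_holds (Motives.AbelianVariety.isSmoothProjective_holds (A := ⨁ fun j => A₃ (κ j))),
    fun p c hc hH => ?_⟩
  have hAκ : ∀ j, IsCMTypeRealisation (Φ₃ (κ j)) (A₃ (κ j)) (ι₃ (κ j)) (θ₃ (κ j)) := fun j => hA (κ j)
  -- every balanced configuration has algebraic weight lines: induct over its generating parts
  have key : ∀ (R : Finset ((j : Fin N) × (Kf (curveSlots i₀ i₁ (κ j)) →+* ℂ))),
      ModelBalanced (fun x => toPt' e τ ((Sigma.map κ (fun _ => id) :
        ((j : Fin N) × (Kf (curveSlots i₀ i₁ (κ j)) →+* ℂ)) → ((m : Fin 3) × (Kf (curveSlots i₀ i₁ m) →+* ℂ))) x)) R →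
      ∀ q, R.card = 2 * q → weightClassesAlg (fun j => A₃ (κ j)) (fun j => ι₃ (κ j)) (2 * q) R ≤
        algebraicClasses (⨁ fun j => A₃ (κ j)).X q := by
    intro R hR
    refine modelBalanced_induction (motive := fun R => ∀ q, R.card = 2 * q →
      weightClassesAlg (fun j => A₃ (κ j)) (fun j => ι₃ (κ j)) (2 * q) R ≤ algebraicClasses (⨁ fun j => A₃ (κ j)).X q)
      (fun q hq => ?_) (fun G R hGR hinj hG ih q hq => ?_) hR
    · obtain rfl : q = 0 := by simpa using hq.symm
      exact fun c _ => hodgeConjectureFor_codim_zero c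
    · obtain ⟨a, ha, hGalg⟩ :=
        exists_weightClassesAlg_le_algebraicClasses_of_part κ hττ hk he_conj hA hweil4 hpair6 hinj hG
      have hRcard : R.card = 2 * (q - a) := by
        have h := Finset.card_union_of_disjoint hGR
        rw [hq, ha] at h
        omega
      have haq : a + (q - a) = q := by
        have h := Finset.card_union_of_disjoint hGR
        rw [hq, ha] at h
        omega
      rw [← Finset.disjUnion_eq_union G R hGR]
      exact weightClassesAlg_union_le_algebraicClasses hAκ haq ha hRcard hGR hGalg (ih (q - a) hRcard)
  have hmem : c ∈ ⨆ S ∈ pohlmannSetsAlg (K := fun j => Kf (curveSlots i₀ i₁ (κ j))) (fun j => Φ₃ (κ j)) p,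
      weightClassesAlg (fun j => A₃ (κ j)) (fun j => ι₃ (κ j)) (2 * p) S := by
    rw [← (Pohlmann1968_thm1_cmAlgebra (fun j => Kf (curveSlots i₀ i₁ (κ j))) (fun j => A₃ (κ j))
      (fun j => Φ₃ (κ j)) (fun j => ι₃ (κ j)) (fun j => θ₃ (κ j)) hAκ p).1]
    exact Submodule.subset_span ⟨hc, hH⟩
  have hle : (⨆ S ∈ pohlmannSetsAlg (K := fun j => Kf (curveSlots i₀ i₁ (κ j))) (fun j => Φ₃ (κ j)) p,
      weightClassesAlg (fun j => A₃ (κ j)) (fun j => ι₃ (κ j)) (2 * p) S) ≤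
      algebraicClasses (⨁ fun j => A₃ (κ j)).X p := by
    refine iSup₂_le fun S hS => ?_
    exact key S (modelBalanced_of_isGaloisBalancedAlg κ hττ hk he_sign he_conj he_gal hΨ hΦ hS.2) p hS.1
  exact hle hmem

end Assembly

/-! ## §4 The frame form modulo Markman -/

section Markman

variable {I : Type} {Kf : I → Type} [∀ i, Field (Kf i)] [∀ i, NumberField (Kf i)] [∀ i, IsCMField (Kf i)]
  {i₀ i₁ : I} {N : ℕ} (κ : Fin N → Fin 3) {τ : Kf i₀ →+* ℂ}
  {A₃ : Fin 3 → AbelianVariety ℂ} {Φ₃ : ∀ m : Fin 3, CMType (Kf (curveSlots i₀ i₁ m))}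
  {ι₃ : ∀ m, 𝓞 (Kf (curveSlots i₀ i₁ m)) →+* End (A₃ m)}
  {θ₃ : ∀ m, Kf (curveSlots i₀ i₁ m) →+* Module.End ℂ (complexBetti (A₃ m).X 1)}

/-- **MAIN THEOREM (frame form).  The Hodge conjecture for every power `⨁_j A₃(κ j)` of `E × B₀ × B₁` — i.e. for
`E^c × B₀^a × B₁^b`, all `a, b, c` — modulo Markman's fourfold theorem.**  `k = Kf i₀` imaginary quadratic with
`τ(δ) = i√d`, `K = Kf i₁ ⊇ i(k)` sextic read in a frame `e`, `A₃ 0 ⊨ (k; {τ})`, `A₃ (m+1) ⊨ (K; Φ_m)` with `Φ_m` of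
sign `true` exactly over the place `m`; then every rational `(p,p)`-class on `⨁_j A₃ (κ j)` is algebraic, for every
slot map `κ : Fin N → Fin 3` and every `p`, GIVEN ONLY `Markman2025_weilClasses_algebraic_abelianFourfold`.
[cite: Markman2025SurveySecant, Thm. 1.2 and §11.5 Step 2] [cite: Pohlmann1968, Thm 1] [cite: GaoUllmo2025, Thm 3.1]
[cite: Milne2020HodgeClassesAV, Thm. 1] [cite: MoonenZarhin1999LowDim, Thm. 0.1] -/
theorem hodgeConjectureFor_biproduct_comp_of_frame_of_markman
    (hW4 : Markman2025_weilClasses_algebraic_abelianFourfold)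
    (h6 : Module.finrank ℚ (Kf i₁) = 6) (h2 : Module.finrank ℚ (Kf i₀) = 2) (i : Kf i₀ →+* Kf i₁)
    {δ : 𝓞 (Kf i₀)} {d : ℕ} (hd : 0 < d) (hδ : ((δ : Kf i₀)) ^ 2 = -(d : Kf i₀))
    (hτ : τ (δ : Kf i₀) = Complex.I * (Real.sqrt d : ℂ))
    (hA : ∀ m, IsCMTypeRealisation (Φ₃ m) (A₃ m) (ι₃ m) (θ₃ m))
    (e : (Kf i₁ →+* ℂ) ≃ ZMod 3 × Bool)
    (he_conj : ∀ s : Kf i₁ →+* ℂ, e (ComplexEmbedding.conjugate s) = ((e s).1, !(e s).2))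
    (he_sign : ∀ s : Kf i₁ →+* ℂ, s.comp i = τ ↔ (e s).2 = true)
    (he_gal : ∀ (j : ZMod 3) (f : Bool), ∃ σ : ℂ ≃+* ℂ, ∀ s : Kf i₁ →+* ℂ,
      e ((σ : ℂ →+* ℂ).comp s) = ((if f then -(e s).1 else (e s).1) + j, (e s).2))
    (hΨ : ∀ σ : Kf i₀ →+* ℂ, σ ∈ (Φ₃ 0).1 ↔ σ = τ)
    (hΦ : ∀ (m : Fin 2) (s : Kf i₁ →+* ℂ), s ∈ (Φ₃ m.succ).1 ↔ (e s).2 = decide ((e s).1.val = m.val)) :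
    HodgeConjectureFor (⨁ fun j => A₃ (κ j)).dim (⨁ fun j => A₃ (κ j)).X :=
  hodgeConjectureFor_biproduct_comp_of_generators κ (CMThreefoldPair.conjugate_ne_of_apply_eq hd hτ)
    (fun σ => DihedralSexticPair.eq_or_eq_conjugate h2 hd hτ σ) hA he_conj he_sign he_gal hΨ hΦ
    (fun m b T hT => weightClassesAlg_le_algebraicClasses_of_image_eq_weil4 hW4 h6 h2 hd hδ hτ hA he_sign hΨ hΦ m b T hT)
    (fun b T hT => weightClassesAlg_le_algebraicClasses_of_image_eq_pair6 hW4 h6 h2 hd hδ hτ hA he_sign hΦ b T hT)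

/-- **The Hodge conjecture for every abelian variety dominated by a power `⨁_j A₃(κ j)`** (frame form, modulo
Markman): every abelian variety isogenous to a product of copies of `E`, `B₀`, `B₁` and their abelian subvarieties
and quotients. [cite: Markman2025SurveySecant, Thm. 1.2] [cite: MumfordAV1970, §19] -/
theorem hodgeConjectureFor_of_avDominatedBy_comp_of_frame_of_markman
    (hW4 : Markman2025_weilClasses_algebraic_abelianFourfold)
    (h6 : Module.finrank ℚ (Kf i₁) = 6) (h2 : Module.finrank ℚ (Kf i₀) = 2) (i : Kf i₀ →+* Kf i₁)
    {δ : 𝓞 (Kf i₀)} {d : ℕ} (hd : 0 < d) (hδ : ((δ : Kf i₀)) ^ 2 = -(d : Kf i₀))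
    (hτ : τ (δ : Kf i₀) = Complex.I * (Real.sqrt d : ℂ))
    (hA : ∀ m, IsCMTypeRealisation (Φ₃ m) (A₃ m) (ι₃ m) (θ₃ m))
    (e : (Kf i₁ →+* ℂ) ≃ ZMod 3 × Bool)
    (he_conj : ∀ s : Kf i₁ →+* ℂ, e (ComplexEmbedding.conjugate s) = ((e s).1, !(e s).2))
    (he_sign : ∀ s : Kf i₁ →+* ℂ, s.comp i = τ ↔ (e s).2 = true)
    (he_gal : ∀ (j : ZMod 3) (f : Bool), ∃ σ : ℂ ≃+* ℂ, ∀ s : Kf i₁ →+* ℂ,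
      e ((σ : ℂ →+* ℂ).comp s) = ((if f then -(e s).1 else (e s).1) + j, (e s).2))
    (hΨ : ∀ σ : Kf i₀ →+* ℂ, σ ∈ (Φ₃ 0).1 ↔ σ = τ)
    (hΦ : ∀ (m : Fin 2) (s : Kf i₁ →+* ℂ), s ∈ (Φ₃ m.succ).1 ↔ (e s).2 = decide ((e s).1.val = m.val))
    {B : AbelianVariety ℂ} (hB : Domination.AVDominatedBy B (⨁ fun j => A₃ (κ j))) :
    HodgeConjectureFor B.dim B.X :=
  Domination.hodgeConjectureFor_of_avDominatedBy
    (hodgeConjectureFor_biproduct_comp_of_frame_of_markman κ hW4 h6 h2 i hd hδ hτ hA e he_conj he_sign he_gal hΨ hΦ)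
    hB

end Markman

end Summit.HodgeConjecture.CorCM.DihedralSexticPairCurvePowers

end
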